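import Literature.MathematicalPhysics.QuantumFieldTheory.Balaban1983to89.B9Eq343GreenPrimeDstarTwoBackgroundIdentity
import Literature.MathematicalPhysics.QuantumFieldTheory.Balaban1983to89.B9Eq3152StoreyHClosedOnModel
import Literature.MathematicalPhysics.QuantumFieldTheory.Balaban1983to89.B9Eq347LocalLetterAlgebra
import Literature.MathematicalPhysics.QuantumFieldTheory.Balaban1983to89.B9Eq341TowerBlockGeometry
import Literature.MathematicalPhysics.QuantumFieldTheory.Balaban1983to89.B9Eq344HessianSliceTwoBackgroundLetters

/-!
# `Balaban1983to89.B9Eq343GreenPrimeDstarTwoBackgroundHolderLetter` — T. Bałaban, *Propagators for lattice gauge theories in a background field*, CMP **99** (1985) 389–434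
# [Balaban1985BackgroundPropagators] Thm 3.4 p. 400 (*«They satisfy Theorem 3.1 with the additional small factor O(1)α₁»*) FOR THE η-HÖLDER MEMBER (3.43) p. 398 OF `G′_k(U)D*_U`,
# with (3.60)–(3.65) pp. 402–403, (3.40) p. 397: **THE TWO-BACKGROUND VALUE AND η-HÖLDER LETTERS OF `y = G′_k(U)D*_U f` ON THE MODEL, CLOSED** — for one-block bond sources
# `f` over `v` (`‖f‖_∞ ≤ F`): `‖(y(U) − y(1))(x)‖ ≤ α·K_y·e^{−κ_y d_m(Πx,v)}·F` and `‖(y(U) − y(1))(x′) − (y(U) − y(1))(x)‖ ≤ α·K_y·e^{−κ_y d_m(Πx,v)}·(d(x,x′)∕L^{n+1})^{½}·F`,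
# constants BEFORE `n, η, m, U`.  Road (Duhamel, `B9Eq343GreenPrimeDstarTwoBackgroundIdentity`): `y(U) − y(1) = G′_k(U)h − G′_k(U)D*_Uq¹`, `h = (D*_U − D*_1)f − s¹ − (penalty
# difference)z¹`, `z¹ = y(1)`; the data letters (all `O(α)`, decaying from `v`: transporter defects `2M_φM_φ′αη`, the window (3.35), the penalty letter); then the CLOSED
# one-background rows of `G′_k(U)`: value ∕ gradient on decaying data (`B9Eq344GreenPrimeRowsOnDecayingData`) + the path lemma `B9Eq340HolderRowOfGradientRow`, and the
# Hölder ∕ value rows of `G′_kD*_U` (`B9Eq343GreenPrimeDstarHolderRowTowerOfFlatWindow` with the flat window letter DISCHARGED by `B9Eq343LocalHolderFlat` +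
# `B9Eq343FlatWindowLetterOfLocalHolder`, `B9Eq342GreenPrimeDstarValueRowTower`) on the block pieces of `q¹` (`B9Eq349BlockMultipliers`), resummed by
# `B9Eq347LocalLetterAlgebra.sum_exp_mul_exp_le`.  Second file of the discharge of gen 103's located letter `Hω` (ROUTE (J′); `H3 ⇐ Hω` = `B9Eq3152ThirdWordPiTwoBackgroundGradLetterOfOmegaHolder`);
# the remaining step is the `R_k`-step `ω = R_ky`.  NE9 crux-team LEAF PROVER 01 (`b2b-balaban-t4-ne9-formalise-leaf-01`), gen 103; cell `pub-balaban`∕`t4`, row NE9, bears_on R4/N22;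
# source READ first-hand (pp. 394–403); composition BY NAME; nothing printed is a hypothesis.
# WHAT IS PROVED (sorry-free; proof lane — 0 `def`): **`exists_letters_GpOfUk_covDiv_sub_flat`**.  HONEST SCOPE: letters on the cell's MODEL (O-NE9-1, #5 UNRULED); constants crude;
# nothing of [B9] asserted as printed; «NE9 ⇐ the named binders»; NE9 NOT PRINTED ∕ NOT PROVED; spine PROVED 0∕9; rung (B)+1 finite T⁴ — NOT infinite volume, NOT mass gap, NOT BetaPertH,
# NOT Clay.  HONEST DEPENDENCY: continuum YM on T⁴ ⇐ BetaPertH ∧ nine spine estimates (0/9 proved); BetaPertH ⇐ (D1) ∧ (D4) ∧ CAP+tail; G-an2-4 gates asym, D1 and NE2/3/4.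

statement-level skeleton of published theorems with citation tags; proofs where landed; nothing here is a claim about the Yang–Mills mass gap
-/


noncomputable section

open scoped InnerProductSpace BigOperators

namespace Literature.MathematicalPhysics.QuantumFieldTheory.Balaban1983to89.B9Eq343GreenPrimeDstarTwoBackgroundHolderLetter

open B4Sect5Torus (TSite tdist tdist_nonneg tdist_triangle tdist_symm torusSum_le)
open B4Sect5Proof (latticeConst latticeConst_nonneg)
open B9SectCLatticeCarrier (Bond bpos btgt shift unshift)
open B9Eq311L2Pairing (WL2)
open B9Eq319QprimeTorus (blockCoord)
open B7Prop1Explicit (U1 mem_U1 norm_inv_sub_one_le)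
open B9Eq310HessianOperator (adTransportW)
open B9Eq315QTower (towerP towerP_apply UlevOf)
open B9Eq315QTowerFlat (UlevOf_one)
open B9Eq316TowerFlatIsOneStep (towerP_eq_fineP_pow siteCast)
open B9Eq324DeltaPrimeATower (laplacePrimeAk GpOfUk)
open B11Eq103H1Complex (SiteL2K BondL2K covDivL2K covLaplaceSiteK equiv_covDivL2K)
open B9Eq33CovDerivVector (covDiv)
open B9Eq384RemainderLetters (norm_adTransportW_sub_le)
open B9Eq342GreenPrimeSupBound (norm_adTransportW_eq)
open B9Eq341TowerBlockGeometry (blkK_eq_blockCoord_siteCast)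
open B9Eq357QprimeTowerKernelForm (blkK)
open B9Eq349BlockMultipliers (exists_block_clm_family sum_block_apply)
open B9Eq347LocalLetterAlgebra (sum_exp_mul_exp_le)
open B9Eq340HolderRowOfGradientRow (holderRow_of_gradientRow)
open B9Eq342GreenPrimeDstarValueRowTower (exists_valueRow_GpOfUk_covDiv)
open B9Eq343LocalHolderFlat (exists_localHolder_flat)
open B9Eq343FlatWindowLetterOfLocalHolder (flatWindowLetter_of_localHolder)
open B9Eq343GreenPrimeDstarHolderRowTowerOfFlatWindow (exists_holderRow_GpOfUk_covDiv_of_flatWindow)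
open B9Eq344GreenPrimeRowsOnDecayingData (exists_rows_GpOfUk_of_decaying)
open B9Eq343GreenPrimeDstarTwoBackgroundIdentity (norm_penalty_sub_flat_apply_le GpOfUk_covDiv_sub_flat_eq laplacePrimeAk_sub_flat_apply_eq)
open B9Eq33CovDerivLocalLetterTower (tdist_bigBlock_bpos_btgt_le_one)
open B9Eq342CovariantResolventAdjointRowLetters (norm_q_apply_le norm_s_apply_le)
open B9Eq344HessianSliceTwoBackgroundLetters (covDiv_trivial_sub_covDiv_apply)

section Main

variable {d : ℕ} (L : ℕ) [NeZero L] (hL3 : 3 ≤ L)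
  {𝔸 : Type*} [NormedRing 𝔸] [NormedAlgebra ℂ 𝔸] [CompleteSpace 𝔸] [NormOneClass 𝔸] [StarRing 𝔸] [FiniteDimensional ℂ 𝔸]
  {W : Type*} [NormedAddCommGroup W] [InnerProductSpace ℂ W] [FiniteDimensional ℂ W] (φ : W ≃ₗ[ℂ] 𝔸)
  {a' Mφ Mφ' : ℝ} (hMφ : 0 ≤ Mφ) (hMφ' : 0 ≤ Mφ') (hφ : ∀ w, ‖φ w‖ ≤ Mφ * ‖w‖) (hφ' : ∀ X, ‖φ.symm X‖ ≤ Mφ' * ‖X‖) (ha' : 0 < a')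
  {r : ℝ} (hr0 : 0 ≤ r) (hr1 : r < 1)
  (τ : 𝔸 →ₗ[ℂ] ℂ) (hτ₂ : ∀ X Y : 𝔸, τ (X * Y) = τ (Y * X)) (hφτ : ∀ X Y : 𝔸, ⟪φ.symm X, φ.symm Y⟫_ℂ = τ (star X * Y))

/-- the neighbouring big blocks: `d_m(Πx, v) ≤ d_m(Π(x − e_μ), v) + 1`. [folklore] [cite: Balaban1985BackgroundPropagators, (3.42) p.397] -/
private theorem tdist_bigBlock_le_unshift_add_one (n : ℕ) (m : Fin d → ℕ) [∀ i, NeZero (m i)] (hm : ∀ i, 1 ≤ m i) (x : TSite d (towerP L m (n + 1))) (μ : Fin d)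
    (v : TSite d m) :
    tdist m (blockCoord (L ^ (n + 1)) m (siteCast (towerP_eq_fineP_pow L m (n + 1)) x)) v ≤
      tdist m (blockCoord (L ^ (n + 1)) m (siteCast (towerP_eq_fineP_pow L m (n + 1)) (unshift μ x))) v + 1 := by
  have h1 := tdist_bigBlock_bpos_btgt_le_one L m (n + 1) hm (unshift μ x, μ)
  have h2 := tdist_triangle hm (blockCoord (L ^ (n + 1)) m (siteCast (towerP_eq_fineP_pow L m (n + 1)) x))
    (blockCoord (L ^ (n + 1)) m (siteCast (towerP_eq_fineP_pow L m (n + 1)) (unshift μ x))) v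
  have e : btgt ((unshift μ x, μ) : Bond d (towerP L m (n + 1))) = x := B9SectCLatticeCarrier.shift_unshift μ x
  have e2 : bpos ((unshift μ x, μ) : Bond d (towerP L m (n + 1))) = unshift μ x := rfl
  rw [e, e2, tdist_symm hm] at h1
  linarith

include hL3 hMφ hMφ' hφ hφ' ha' hr0 hr1 hτ₂ hφτ in
set_option maxHeartbeats 6400000 in
/-- **THE TWO-BACKGROUND VALUE AND η-HÖLDER LETTERS OF `G′_k(U)D*_U f`, WITH THE SMALL FACTOR `α`** — see the module docstring.
[cite: Balaban1985BackgroundPropagators, Thm 3.4 p.400, (3.60)–(3.65) pp.402–403, Thm 3.1 (3.43) p.398, (3.40) p.397] -/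
theorem exists_letters_GpOfUk_covDiv_sub_flat (hd : 1 ≤ d) :
    ∃ αy Ky κy : ℝ, 0 < αy ∧ 0 ≤ Ky ∧ 0 < κy ∧
      ∀ (n : ℕ) (η : ℝ), η * (L : ℝ) ^ (n + 1) = 1 →
      ∀ (c₀ c₁ : ℝ) [Fact (0 < c₀)] [Fact (0 < c₁)], c₀ * ((L : ℝ) ^ (n + 1)) ^ d = c₁ →
      ∀ (m : Fin d → ℕ) [∀ i, NeZero (m i)] (U : Bond d (towerP L m (n + 1)) → 𝔸ˣ),
      ∀ (α : ℝ), 0 ≤ α → α ≤ αy → (∀ b, U b ∈ U1 𝔸) → (∀ b, ‖(U b : 𝔸) - 1‖ ≤ α * η) →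
        (∀ (x : TSite d (towerP L m (n + 1))) (μ : Fin d), ‖(U (x, μ) : 𝔸) - U (unshift μ x, μ)‖ ≤ α * η ^ 2) →
      ∀ (εU : ℕ → ℝ), (∀ j, 0 ≤ εU j) → (∀ j, εU j ≤ 1) → (∀ j < n + 1, εU j ≤ α * r ^ j) →
        (∀ (j : ℕ) (b : Bond d (towerP L m (j + 1))), ‖(UlevOf L m (n + 1) U j b : 𝔸) - 1‖ ≤ εU j) →
        (∀ (j : ℕ) (b : Bond d (towerP L m (j + 1))), UlevOf L m (n + 1) U j b ∈ U1 𝔸) →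
        (∀ b, star (U b : 𝔸) = ((U b)⁻¹ : 𝔸ˣ)) →
        (∀ (j : ℕ) (b : Bond d (towerP L m (j + 1))) (w : W), ‖adTransportW φ (UlevOf L m (n + 1) U j) b w‖ ≤ ‖w‖) →
      ∀ (hpos' : ∀ x : SiteL2K ℂ d (towerP L m (n + 1)) c₀ W, x ≠ 0 → 0 < RCLike.re ⟪x, laplacePrimeAk L m n φ η U a' (c₁ := c₁) x⟫_ℂ)
        (hpos'₁ : ∀ x : SiteL2K ℂ d (towerP L m (n + 1)) c₀ W, x ≠ 0 →
          0 < RCLike.re ⟪x, laplacePrimeAk L m n φ η (fun _ : Bond d (towerP L m (n + 1)) => (1 : 𝔸ˣ)) a' (c₁ := c₁) x⟫_ℂ)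
        (v : TSite d m) (f : BondL2K ℂ d (towerP L m (n + 1)) c₀ W) (F : ℝ),
        (∀ b, blockCoord (L ^ (n + 1)) m (siteCast (towerP_eq_fineP_pow L m (n + 1)) (bpos b)) ≠ v →
          WL2.equiv ℂ (fun _ : Bond d (towerP L m (n + 1)) => c₀) W f b = 0) →
        (∀ b, ‖WL2.equiv ℂ (fun _ : Bond d (towerP L m (n + 1)) => c₀) W f b‖ ≤ F) →
      (∀ x : TSite d (towerP L m (n + 1)),
        ‖WL2.equiv ℂ (fun _ : TSite d (towerP L m (n + 1)) => c₀) W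
            (GpOfUk L m n φ η U a' (c₁ := c₁) hpos' (covDivL2K ℂ c₀ ((η : ℂ))⁻¹ (adTransportW φ fun b => (U b)⁻¹) f) -
              GpOfUk L m n φ η (fun _ : Bond d (towerP L m (n + 1)) => (1 : 𝔸ˣ)) a' (c₁ := c₁) hpos'₁
                (covDivL2K ℂ c₀ ((η : ℂ))⁻¹ (adTransportW φ fun b => ((fun _ : Bond d (towerP L m (n + 1)) => (1 : 𝔸ˣ)) b)⁻¹) f)) x‖ ≤
          α * Ky * Real.exp (-(κy * tdist m (blockCoord (L ^ (n + 1)) m (siteCast (towerP_eq_fineP_pow L m (n + 1)) x)) v)) * F) ∧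
      (∀ x x' : TSite d (towerP L m (n + 1)), tdist (towerP L m (n + 1)) x x' ≤ (L : ℝ) ^ (n + 1) →
        ‖WL2.equiv ℂ (fun _ : TSite d (towerP L m (n + 1)) => c₀) W
              (GpOfUk L m n φ η U a' (c₁ := c₁) hpos' (covDivL2K ℂ c₀ ((η : ℂ))⁻¹ (adTransportW φ fun b => (U b)⁻¹) f) -
                GpOfUk L m n φ η (fun _ : Bond d (towerP L m (n + 1)) => (1 : 𝔸ˣ)) a' (c₁ := c₁) hpos'₁
                  (covDivL2K ℂ c₀ ((η : ℂ))⁻¹ (adTransportW φ fun b => ((fun _ : Bond d (towerP L m (n + 1)) => (1 : 𝔸ˣ)) b)⁻¹) f)) x' -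
            WL2.equiv ℂ (fun _ : TSite d (towerP L m (n + 1)) => c₀) W
              (GpOfUk L m n φ η U a' (c₁ := c₁) hpos' (covDivL2K ℂ c₀ ((η : ℂ))⁻¹ (adTransportW φ fun b => (U b)⁻¹) f) -
                GpOfUk L m n φ η (fun _ : Bond d (towerP L m (n + 1)) => (1 : 𝔸ˣ)) a' (c₁ := c₁) hpos'₁
                  (covDivL2K ℂ c₀ ((η : ℂ))⁻¹ (adTransportW φ fun b => ((fun _ : Bond d (towerP L m (n + 1)) => (1 : 𝔸ˣ)) b)⁻¹) f)) x‖ ≤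
          α * Ky * Real.exp (-(κy * tdist m (blockCoord (L ^ (n + 1)) m (siteCast (towerP_eq_fineP_pow L m (n + 1)) x)) v)) *
            (tdist (towerP L m (n + 1)) x x' / (L : ℝ) ^ (n + 1)) ^ ((1 : ℝ) / 2) * F) := by
  classical
  obtain ⟨hL2, hL1⟩ : 2 ≤ L ∧ 1 ≤ L := ⟨le_trans (by norm_num) hL3, le_trans (by norm_num) hL3⟩
  obtain ⟨αv, Bv, δv, hαv, hBv, hδv, HV⟩ := exists_valueRow_GpOfUk_covDiv L hL3 φ hMφ hMφ' hφ hφ' ha' hr0 hr1 τ hτ₂ hφτ hd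
  obtain ⟨Cloc, hCloc, hloc⟩ := exists_localHolder_flat (d := d) L (W := W)
  have HflatW := flatWindowLetter_of_localHolder (d := d) L (W := W) hL2 Cloc hloc
  obtain ⟨αh, Bh, δh, hαh, hBh, hδh, HH⟩ := exists_holderRow_GpOfUk_covDiv_of_flatWindow L hL3 φ hMφ hMφ' hφ hφ' ha' hr0 hr1 τ hτ₂ hφτ hd
    (β := (1 : ℝ) / 2) (by norm_num) (by norm_num) (Cloc * (16 * (d : ℝ) + 1) * Real.exp (4 * (d : ℝ))) (by positivity) HflatW
  obtain ⟨αr, Br, κr, hαr, hBr, hκr, HR⟩ := exists_rows_GpOfUk_of_decaying L hL3 φ hMφ hMφ' hφ hφ' ha' hr0 hr1 τ hτ₂ hφτ hd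
  obtain ⟨hd1, hd0⟩ : (1 : ℝ) ≤ d ∧ (0 : ℝ) ≤ d := ⟨by exact_mod_cast hd, Nat.cast_nonneg d⟩
  set cT : ℝ := 2 * Mφ * Mφ' with hcT
  set ck : ℝ := ((d * (L - 1) : ℕ) : ℝ) * (3 / (1 - r)) with hck
  set cs : ℝ := ((d * (L - 1) : ℕ) : ℝ) * (2 * Mφ * Mφ' / (1 - r)) with hcs
  have h1r : 0 < 1 - r := by linarith
  set Cq : ℝ := (ck * Real.exp (ck * (1 / 16)) + Mφ * Mφ' * (cs * Real.exp (cs * (1 / 16)))) / 4 with hCq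
  set CP : ℝ := Mφ' * (|a'| * Cq * (2 + Cq * (4 * (1 / 16))) * 4 * Mφ) with hCP
  obtain ⟨hcT0, hCq0, hCP0⟩ : 0 ≤ cT ∧ 0 ≤ Cq ∧ 0 ≤ CP := ⟨by positivity, by positivity, by positivity⟩
  set δ₀ : ℝ := min δv (min δh κr) with hδ₀
  have hδ₀0 : 0 < δ₀ := lt_min hδv (lt_min hδh hκr)
  obtain ⟨hδ₀v, hδ₀h, hδ₀r⟩ : δ₀ ≤ δv ∧ δ₀ ≤ δh ∧ δ₀ ≤ κr :=
    ⟨min_le_left _ _, (min_le_right _ _).trans (min_le_left _ _), (min_le_right _ _).trans (min_le_right _ _)⟩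
  set S : ℝ := latticeConst d (δ₀ / 2) with hS
  have hS0 : 0 ≤ S := latticeConst_nonneg d (half_pos hδ₀0).le
  -- the data size (per unit of `α·F`) and the final constants
  set Ch : ℝ := (cT * d + d * cT * (cT + 1) * Bv + CP * Bv) * Real.exp δ₀ with hCh
  set Cq1 : ℝ := 2 * cT * Bv * Real.exp δ₀ with hCq1
  obtain ⟨hCh0, hCq10⟩ : 0 ≤ Ch ∧ 0 ≤ Cq1 := ⟨by positivity, by positivity⟩
  set KA : ℝ := Br * latticeConst d (2 * κr - δ₀) * Ch with hKA
  have hKA0 : 0 ≤ KA := by have := latticeConst_nonneg d (show 0 ≤ 2 * κr - δ₀ by linarith); positivity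
  set Ky : ℝ := (KA + d * (KA + cT * KA) * Real.exp δ₀) + (Bv + Bh) * Cq1 * S with hKy
  refine ⟨min (min αv αh) (min αr (1 / 16)), Ky, δ₀ / 2, lt_min (lt_min hαv hαh) (lt_min hαr (by norm_num)), by positivity, half_pos hδ₀0, ?_⟩
  intro n η hηL c₀ c₁ _ _ hw m _ U α hα hαle hUb hUη hUgrad εU hεU hεU1 hεg hUε hLb hUst hRlev hpos' hpos'₁ v f F hfv hfF
  obtain ⟨hαv', hαh', hαr', hα16⟩ : α ≤ αv ∧ α ≤ αh ∧ α ≤ αr ∧ α ≤ 1 / 16 :=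
    ⟨hαle.trans ((min_le_left _ _).trans (min_le_left _ _)), hαle.trans ((min_le_left _ _).trans (min_le_right _ _)),
      hαle.trans ((min_le_right _ _).trans (min_le_left _ _)), hαle.trans ((min_le_right _ _).trans (min_le_right _ _))⟩
  obtain ⟨hα1, hm⟩ : α ≤ 1 ∧ ∀ i, 1 ≤ m i := ⟨hα16.trans (by norm_num), fun i => Nat.one_le_iff_ne_zero.mpr (NeZero.ne (m i))⟩
  have hF : 0 ≤ F := (norm_nonneg _).trans (hfF (fun _ => 0, ⟨0, hd⟩))
  have hK1 : (1 : ℝ) ≤ (L : ℝ) ^ (n + 1) := one_le_pow₀ (by exact_mod_cast hL1)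
  have hK0 : (0 : ℝ) < (L : ℝ) ^ (n + 1) := lt_of_lt_of_le one_pos hK1
  set K : ℝ := (L : ℝ) ^ (n + 1) with hK
  obtain ⟨hη0, hηK⟩ : 0 < η ∧ η⁻¹ = K := ⟨by nlinarith only [hηL, hK0], inv_eq_of_mul_eq_one_right hηL⟩
  obtain ⟨hηeq, hη1⟩ : η = K⁻¹ ∧ η ≤ 1 := ⟨by rw [← hηK, inv_inv], by rw [← inv_inv η, hηK]; exact inv_le_one_of_one_le₀ hK1⟩
  have hcn : ‖((η : ℂ))⁻¹‖ = K := by rw [norm_inv, Complex.norm_real, Real.norm_eq_abs, abs_of_pos hη0, hηK]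
  set piS : TSite d (towerP L m (n + 1)) → TSite d m := fun x => blockCoord (L ^ (n + 1)) m (siteCast (towerP_eq_fineP_pow L m (n + 1)) x) with hpiS
  set piB : Bond d (towerP L m (n + 1)) → TSite d m := fun b => piS (bpos b) with hpiB
  set E : TSite d (towerP L m (n + 1)) → ℝ := fun x => Real.exp (-(δ₀ * tdist m (piS x) v)) with hE
  have hE0 : ∀ x, 0 ≤ E x := fun x => Real.exp_nonneg _
  set R := adTransportW φ U with hR
  set Sd := adTransportW φ (fun bb => (U bb)⁻¹) with hSd
  set DsU := covDivL2K ℂ c₀ ((η : ℂ))⁻¹ Sd with hDsU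
  set Ds1 := covDivL2K ℂ c₀ ((η : ℂ))⁻¹ (adTransportW φ fun b => ((fun _ : Bond d (towerP L m (n + 1)) => (1 : 𝔸ˣ)) b)⁻¹) with hDs1
  obtain ⟨z1, hz1⟩ : ∃ z : SiteL2K ℂ d (towerP L m (n + 1)) c₀ W, z = GpOfUk L m n φ η (fun _ : Bond d (towerP L m (n + 1)) => (1 : 𝔸ˣ)) a' (c₁ := c₁) hpos'₁ (Ds1 f) :=
    ⟨_, rfl⟩
  obtain ⟨zf, hzf⟩ : ∃ g : TSite d (towerP L m (n + 1)) → W, g = WL2.equiv ℂ (fun _ : TSite d (towerP L m (n + 1)) => c₀) W z1 := ⟨_, rfl⟩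
  have hUst' : ∀ bb, star (((U bb)⁻¹ : 𝔸ˣ) : 𝔸) = ((((U bb)⁻¹)⁻¹ : 𝔸ˣ) : 𝔸) := fun bb => by rw [inv_inv, ← hUst bb, star_star]
  have hRε : ∀ bb w, ‖R bb w - w‖ ≤ cT * (α * η) * ‖w‖ := fun bb w => norm_adTransportW_sub_le φ hφ hφ' hMφ' U bb (hUb bb) (hUη bb) w
  have hSε : ∀ bb w, ‖Sd bb w - w‖ ≤ cT * (α * η) * ‖w‖ := fun bb w =>
    norm_adTransportW_sub_le φ hφ hφ' hMφ' (fun bb => (U bb)⁻¹) bb (inv_mem (hUb bb)) ((norm_inv_sub_one_le (hUb bb)).trans (hUη bb)) w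
  have hSε' : ∀ (x : TSite d (towerP L m (n + 1))) (μ : Fin d) (w : W), ‖Sd (x, μ) w - Sd (unshift μ x, μ) w‖ ≤ cT * (α * η ^ 2) * ‖w‖ := fun x μ w =>
    (B9Eq373TransporterLipschitzLetters.norm_adTransportW_inv_sub_adTransportW_inv_le φ hφ hφ' hMφ' U U (x, μ) (unshift μ x, μ) (hUb _) (hUb _) w).trans
      (by gcongr; exact hUgrad x μ)
  -- the flat class data and the flat value letter of `z¹ = G′_k(1)D*_1f`
  have hUb1 : ∀ bb : Bond d (towerP L m (n + 1)), (fun _ : Bond d (towerP L m (n + 1)) => (1 : 𝔸ˣ)) bb ∈ U1 𝔸 := fun _ => one_mem _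
  have hUη1 : ∀ bb : Bond d (towerP L m (n + 1)), ‖(((fun _ : Bond d (towerP L m (n + 1)) => (1 : 𝔸ˣ)) bb : 𝔸ˣ) : 𝔸) - 1‖ ≤ 0 * η := fun _ => by simp
  have hUgrad1 : ∀ (x : TSite d (towerP L m (n + 1))) (ν : Fin d), ‖(((fun _ : Bond d (towerP L m (n + 1)) => (1 : 𝔸ˣ)) (x, ν) : 𝔸ˣ) : 𝔸) -
      (fun _ : Bond d (towerP L m (n + 1)) => (1 : 𝔸ˣ)) (unshift ν x, ν)‖ ≤ 0 * η ^ 2 := fun _ _ => by simp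
  have hεg1 : ∀ j < n + 1, (fun _ : ℕ => (0 : ℝ)) j ≤ 0 * r ^ j := fun _ _ => by simp
  have hUε1 : ∀ (j : ℕ) (bb : Bond d (towerP L m (j + 1))), ‖(UlevOf L m (n + 1) (fun _ : Bond d (towerP L m (n + 1)) => (1 : 𝔸ˣ)) j bb : 𝔸) - 1‖ ≤ (fun _ : ℕ => (0 : ℝ)) j :=
    fun j bb => by rw [UlevOf_one]; simp
  have hLb1 : ∀ (j : ℕ) (bb : Bond d (towerP L m (j + 1))), UlevOf L m (n + 1) (fun _ : Bond d (towerP L m (n + 1)) => (1 : 𝔸ˣ)) j bb ∈ U1 𝔸 := fun j bb => by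
    rw [UlevOf_one]; exact one_mem _
  have hRlev1 : ∀ (j : ℕ) (bb : Bond d (towerP L m (j + 1))) (w : W), ‖adTransportW φ (UlevOf L m (n + 1) (fun _ : Bond d (towerP L m (n + 1)) => (1 : 𝔸ˣ)) j) bb w‖ ≤ ‖w‖ :=
    fun j bb w => by rw [UlevOf_one, B5Eq172HodgePositivity.adTransportW_one, LinearMap.id_apply]
  have hUst1 : ∀ bb : Bond d (towerP L m (n + 1)), star ((fun _ : Bond d (towerP L m (n + 1)) => (1 : 𝔸ˣ)) bb : 𝔸) =
      ((((fun _ : Bond d (towerP L m (n + 1)) => (1 : 𝔸ˣ)) bb)⁻¹ : 𝔸ˣ) : 𝔸) := fun _ => by simp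
  have hz : ∀ x, ‖zf x‖ ≤ Bv * Real.exp (-(δv * tdist m (piS x) v)) * F := fun x => by
    rw [hzf, hz1, hDs1]
    exact HV n η hηL c₀ c₁ hw m (fun _ => 1) 0 le_rfl hαv.le hUb1 hUη1 hUgrad1 (fun _ => 0) (fun _ => le_rfl) hεg1 hUε1 hLb1 hUst1 hRlev1 hpos'₁ v f F hfv hfF x
  have hzE : ∀ x, ‖zf x‖ ≤ Bv * F * E x := fun x => by
    refine (hz x).trans ?_
    have : Real.exp (-(δv * tdist m (piS x) v)) ≤ Real.exp (-(δ₀ * tdist m (piS x) v)) := Real.exp_le_exp.2 (by nlinarith [tdist_nonneg m (piS x) v, hδ₀v])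
    rw [hE]; nlinarith [mul_le_mul_of_nonneg_left this (mul_nonneg hBv hF)]
  have hEnb : ∀ x (μ : Fin d), E (unshift μ x) ≤ Real.exp δ₀ * E x := fun x μ => by
    rw [hE]; dsimp only; rw [← Real.exp_add]
    exact Real.exp_le_exp.2 (by nlinarith [tdist_bigBlock_le_unshift_add_one L n m hm x μ v, hδ₀0.le])
  have hEsh : ∀ (bb : Bond d (towerP L m (n + 1))), E (btgt bb) ≤ Real.exp δ₀ * E (bpos bb) := fun bb => by
    rw [hE]; dsimp only; rw [← Real.exp_add]
    have h1 : tdist m (piS (bpos bb)) (piS (btgt bb)) ≤ 1 := tdist_bigBlock_bpos_btgt_le_one L m (n + 1) hm bb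
    have h2 := tdist_triangle hm (piS (bpos bb)) (piS (btgt bb)) v
    exact Real.exp_le_exp.2 (by nlinarith [hδ₀0.le])
  have he1 : 1 ≤ Real.exp δ₀ := Real.one_le_exp hδ₀0.le
  -- (1) THE DATA LETTERS (all with the small factor `α`)
  have hS₁w : ∀ bb w, adTransportW φ (fun b => ((fun _ : Bond d (towerP L m (n + 1)) => (1 : 𝔸ˣ)) b)⁻¹) bb w = w := fun bb w => by
    show adTransportW φ (fun _ : Bond d (towerP L m (n + 1)) => (1 : 𝔸ˣ)⁻¹) bb w = w; rw [B5Eq172HodgePositivity.adTransportW_inv_one, LinearMap.id_apply]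
  have hfE : ∀ bb : Bond d (towerP L m (n + 1)), ‖WL2.equiv ℂ (fun _ : Bond d (towerP L m (n + 1)) => c₀) W f bb‖ ≤ F * (Real.exp δ₀ * E (btgt bb)) := by
    intro bb
    by_cases hb : piB bb = v
    · refine (hfF bb).trans (le_mul_of_one_le_right hF ?_)
      have h1 : tdist m (piS (btgt bb)) v ≤ 1 := by
        have := tdist_bigBlock_bpos_btgt_le_one L m (n + 1) hm bb; rw [tdist_symm hm] at this; have e : piS (bpos bb) = v := hb; rw [← e]; exact this
      rw [hE]; dsimp only; rw [← Real.exp_zero, ← Real.exp_add]; exact Real.exp_le_exp.2 (by nlinarith [hδ₀0.le])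
    · rw [hfv bb hb, norm_zero]; positivity
  have hDf : ∀ x, ‖WL2.equiv ℂ (fun _ : TSite d (towerP L m (n + 1)) => c₀) W ((DsU - Ds1) f) x‖ ≤ α * (cT * d) * F * Real.exp δ₀ * E x := by
    intro x
    rw [LinearMap.sub_apply, WL2.equiv_sub, Pi.sub_apply, hDsU, hDs1, equiv_covDivL2K, equiv_covDivL2K, norm_sub_rev,
      covDiv_trivial_sub_covDiv_apply _ Sd _ hS₁w, norm_smul, hcn]
    calc K * ‖∑ μ, (WL2.equiv ℂ (fun _ : Bond d (towerP L m (n + 1)) => c₀) W f (unshift μ x, μ) -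
            Sd (unshift μ x, μ) (WL2.equiv ℂ (fun _ : Bond d (towerP L m (n + 1)) => c₀) W f (unshift μ x, μ)))‖
        ≤ K * ∑ μ, cT * (α * η) * (F * (Real.exp δ₀ * E x)) := by
          refine mul_le_mul_of_nonneg_left ((norm_sum_le _ _).trans (Finset.sum_le_sum fun μ _ => ?_)) hK0.le
          rw [norm_sub_rev]
          refine (hSε _ _).trans (mul_le_mul_of_nonneg_left ((hfE _).trans (le_of_eq ?_)) (by positivity))
          rw [show btgt ((unshift μ x, μ) : Bond d (towerP L m (n + 1))) = x from B9SectCLatticeCarrier.shift_unshift μ x]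
      _ = α * (cT * d) * F * Real.exp δ₀ * E x * (K * η) := by rw [Finset.sum_const, Finset.card_univ, Fintype.card_fin, nsmul_eq_mul]; ring
      _ = α * (cT * d) * F * Real.exp δ₀ * E x := by rw [hηeq, mul_inv_cancel₀ hK0.ne', mul_one]
  -- (1b) the flat solution `z¹` and its perturbation data `q¹`, `s¹`, penalty
  obtain ⟨q1v, hq1v⟩ : ∃ q : BondL2K ℂ d (towerP L m (n + 1)) c₀ W, q = (WL2.equiv ℂ (fun _ : Bond d (towerP L m (n + 1)) => c₀) W).symm
      fun b : Bond d (towerP L m (n + 1)) => ((η : ℂ))⁻¹ • ((R b (zf (btgt b)) - zf (btgt b)) - (Sd b (zf (bpos b)) - zf (bpos b))) := ⟨_, rfl⟩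
  obtain ⟨s1v, hs1v⟩ : ∃ sv : SiteL2K ℂ d (towerP L m (n + 1)) c₀ W, sv = (WL2.equiv ℂ (fun _ : TSite d (towerP L m (n + 1)) => c₀) W).symm
      fun x : TSite d (towerP L m (n + 1)) => (((η : ℂ))⁻¹ ^ 2) • ∑ μ, ((Sd (unshift μ x, μ) (Sd (unshift μ x, μ) (zf (unshift μ x)) - zf (unshift μ x)) -
        (Sd (unshift μ x, μ) (zf (unshift μ x)) - zf (unshift μ x))) + (Sd (unshift μ x, μ) (zf x) - Sd (x, μ) (zf x))) := ⟨_, rfl⟩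
  have hq : ∀ bb, ‖WL2.equiv ℂ (fun _ : Bond d (towerP L m (n + 1)) => c₀) W q1v bb‖ ≤ α * Cq1 * F * E (bpos bb) := by
    intro bb; rw [hq1v, Equiv.apply_symm_apply, ← Complex.ofReal_inv]
    refine (norm_q_apply_le (P := towerP L m (n + 1)) η⁻¹ R Sd hRε hSε zf bb).trans ?_
    rw [abs_of_pos (inv_pos.2 hη0), hηK]
    calc K * (cT * (α * η) * (‖zf (btgt bb)‖ + ‖zf (bpos bb)‖)) ≤ K * (cT * (α * η) * (Bv * F * (Real.exp δ₀ * E (bpos bb)) + Bv * F * (Real.exp δ₀ * E (bpos bb)))) := by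
          gcongr
          · exact (hzE _).trans (mul_le_mul_of_nonneg_left (hEsh bb) (by positivity))
          · exact (hzE _).trans (mul_le_mul_of_nonneg_left (le_mul_of_one_le_left (hE0 _) he1) (by positivity))
      _ = α * Cq1 * F * E (bpos bb) * (K * η) := by rw [hCq1]; ring
      _ = α * Cq1 * F * E (bpos bb) := by rw [hηeq, mul_inv_cancel₀ hK0.ne', mul_one]
  have hs : ∀ x, ‖WL2.equiv ℂ (fun _ : TSite d (towerP L m (n + 1)) => c₀) W s1v x‖ ≤ α * (d * cT * (cT + 1) * Bv) * F * Real.exp δ₀ * E x := by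
    intro x
    rw [hs1v, Equiv.apply_symm_apply, show (((η : ℂ))⁻¹ ^ 2) = ((η⁻¹ ^ 2 : ℝ) : ℂ) by push_cast; ring]
    refine (norm_s_apply_le (P := towerP L m (n + 1)) η⁻¹ Sd hSε hSε' (by positivity) zf x).trans ?_; rw [hηK]
    have hterm : ∀ μ : Fin d, (cT * (α * η)) ^ 2 * ‖zf (unshift μ x)‖ + cT * (α * η ^ 2) * ‖zf x‖ ≤ η ^ 2 * (α * (cT * (cT + 1) * Bv) * F * Real.exp δ₀ * E x) := by
      intro μ
      have h1 : ‖zf (unshift μ x)‖ ≤ Bv * F * (Real.exp δ₀ * E x) := (hzE _).trans (mul_le_mul_of_nonneg_left (hEnb x μ) (by positivity))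
      have h2 : ‖zf x‖ ≤ Bv * F * (Real.exp δ₀ * E x) := (hzE _).trans (mul_le_mul_of_nonneg_left (le_mul_of_one_le_left (hE0 _) he1) (by positivity))
      have hα2 : α ^ 2 ≤ α := by nlinarith
      nlinarith [mul_le_mul_of_nonneg_left h1 (by positivity : 0 ≤ (cT * (α * η)) ^ 2), mul_le_mul_of_nonneg_left h2 (by positivity : 0 ≤ cT * (α * η ^ 2)),
        mul_le_mul_of_nonneg_right hα2 (by positivity : 0 ≤ cT ^ 2 * η ^ 2 * (Bv * F * (Real.exp δ₀ * E x)))]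
    calc K ^ 2 * ∑ μ : Fin d, ((cT * (α * η)) ^ 2 * ‖zf (unshift μ x)‖ + cT * (α * η ^ 2) * ‖zf x‖)
        ≤ K ^ 2 * ∑ _μ : Fin d, η ^ 2 * (α * (cT * (cT + 1) * Bv) * F * Real.exp δ₀ * E x) := mul_le_mul_of_nonneg_left (Finset.sum_le_sum fun μ _ => hterm μ) (by positivity)
      _ = α * (d * cT * (cT + 1) * Bv) * F * Real.exp δ₀ * E x * (K * η) ^ 2 := by rw [Finset.sum_const, Finset.card_univ, Fintype.card_fin, nsmul_eq_mul]; ring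
      _ = α * (d * cT * (cT + 1) * Bv) * F * Real.exp δ₀ * E x := by rw [hηeq, mul_inv_cancel₀ hK0.ne', one_pow, mul_one]
  have hpen : ∀ x, ‖WL2.equiv ℂ (fun _ : TSite d (towerP L m (n + 1)) => c₀) W ((laplacePrimeAk L m n φ η U a' (c₀ := c₀) (c₁ := c₁) -
          covLaplaceSiteK (c₀ := c₀) ((η : ℂ))⁻¹ (adTransportW φ U) (adTransportW φ fun b => (U b)⁻¹)) z1) x -
        WL2.equiv ℂ (fun _ : TSite d (towerP L m (n + 1)) => c₀) W ((laplacePrimeAk L m n φ η (fun _ : Bond d (towerP L m (n + 1)) => (1 : 𝔸ˣ)) a' (c₀ := c₀) (c₁ := c₁) -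
          covLaplaceSiteK (c₀ := c₀) ((η : ℂ))⁻¹ (adTransportW φ (fun _ : Bond d (towerP L m (n + 1)) => (1 : 𝔸ˣ)))
            (adTransportW φ fun b => ((fun _ : Bond d (towerP L m (n + 1)) => (1 : 𝔸ˣ)) b)⁻¹)) z1) x‖ ≤ α * (CP * Bv) * F * E x := by
    intro x
    have hB : ∀ x', blkK L m n x' = blkK L m n x → ‖WL2.equiv ℂ (fun _ : TSite d (towerP L m (n + 1)) => c₀) W z1 x'‖ ≤ Bv * F * E x := fun x' hx' => by
      rw [← hzf]
      refine (hzE x').trans (le_of_eq ?_)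
      have e : piS x' = piS x := by
        have h1 := blkK_eq_blockCoord_siteCast L m n x'; have h2 := blkK_eq_blockCoord_siteCast L m n x
        rw [hpiS]; dsimp only; rw [← h1, ← h2, hx']
      rw [hE]; dsimp only; rw [e]
    refine (norm_penalty_sub_flat_apply_le L φ hMφ hMφ' hφ hφ' hr0 hr1 n η c₀ c₁ hw m U α hα hα16 εU hεU hεU1 hεg hUε hLb z1 x (Bv * F * E x) hB).trans ?_
    have hX : 0 ≤ Bv * F * E x := by positivity
    have h4 : Cq * (4 * α) ≤ Cq * (4 * (1 / 16)) := by gcongr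
    calc _ ≤ Mφ' * (|a'| * Cq * (2 + Cq * (4 * (1 / 16))) * (4 * α) * (Mφ * (Bv * F * E x))) := by gcongr
      _ = α * (CP * Bv) * F * E x := by rw [hCP]; ring
  -- (2) the site data `h = (D*_U − D*_1)f − s¹ − (penalty difference)z¹` and the rows of `G′_k(U)h`
  obtain ⟨hdat, hhdat⟩ : ∃ hd' : SiteL2K ℂ d (towerP L m (n + 1)) c₀ W, hd' = (DsU - Ds1) f - s1v - ((laplacePrimeAk L m n φ η U a' (c₀ := c₀) (c₁ := c₁) -
          covLaplaceSiteK (c₀ := c₀) ((η : ℂ))⁻¹ (adTransportW φ U) (adTransportW φ fun b => (U b)⁻¹)) z1 -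
        (laplacePrimeAk L m n φ η (fun _ : Bond d (towerP L m (n + 1)) => (1 : 𝔸ˣ)) a' (c₀ := c₀) (c₁ := c₁) -
          covLaplaceSiteK (c₀ := c₀) ((η : ℂ))⁻¹ (adTransportW φ (fun _ : Bond d (towerP L m (n + 1)) => (1 : 𝔸ˣ)))
            (adTransportW φ fun b => ((fun _ : Bond d (towerP L m (n + 1)) => (1 : 𝔸ˣ)) b)⁻¹)) z1) := ⟨_, rfl⟩
  have hh : ∀ x, ‖WL2.equiv ℂ (fun _ : TSite d (towerP L m (n + 1)) => c₀) W hdat x‖ ≤ α * Ch * F * Real.exp (-(δ₀ * tdist m (piS x) v)) := by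
    intro x
    rw [hhdat, WL2.equiv_sub, WL2.equiv_sub, Pi.sub_apply, Pi.sub_apply, WL2.equiv_sub, Pi.sub_apply]
    refine (norm_sub_le _ _).trans ((add_le_add ((norm_sub_le _ _).trans (add_le_add (hDf x) (hs x))) (hpen x)).trans ?_)
    have hEx : E x = Real.exp (-(δ₀ * tdist m (piS x) v)) := rfl
    rw [← hEx, hCh]
    have hX : 0 ≤ α * F * E x := by positivity
    nlinarith [mul_le_mul_of_nonneg_left he1 (by positivity : 0 ≤ α * (CP * Bv) * F * E x)]
  have hNh : 0 ≤ α * Ch * F := mul_nonneg (mul_nonneg hα hCh0) hF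
  obtain ⟨hGval, hGgrad⟩ := HR n η hηL c₀ c₁ hw m U α hα hαr' hUb hUη hUgrad εU hεU hεg hUε hLb hUst hRlev hpos' v hdat (α * Ch * F) δ₀ hNh hδ₀0 hδ₀r hh
  have hKcast : η * ((L ^ (n + 1) : ℕ) : ℝ) = 1 := by push_cast; exact hηL
  have hKA' : 0 ≤ Br * latticeConst d (2 * κr - δ₀) * (α * Ch * F) := mul_nonneg (mul_nonneg hBr (latticeConst_nonneg d (by linarith))) hNh
  have hGhold := holderRow_of_gradientRow (L ^ (n + 1)) m φ hφ hφ' hMφ hMφ' (towerP_eq_fineP_pow L m (n + 1)) hm U hη0 hKcast hα hUb hUη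
    (WL2.equiv ℂ (fun _ : TSite d (towerP L m (n + 1)) => c₀) W (GpOfUk L m n φ η U a' (c₁ := c₁) hpos' hdat)) v (N := Br * latticeConst d (2 * κr - δ₀) * (α * Ch * F))
    (G := Br * latticeConst d (2 * κr - δ₀) * (α * Ch * F)) (δ := δ₀) (ε := (1 : ℝ) / 2) hKA' hKA' hδ₀0.le (by norm_num) hGval
    (fun bb => by rw [← B11Eq103H1Complex.equiv_covDerivL2K]; exact hGgrad bb)
  rw [show ((L ^ (n + 1) : ℕ) : ℝ) = K by push_cast; rfl] at hGhold
  -- (3) the word `G′_k(U)D*_Uq¹`: the Hölder and value rows on the block pieces of `q¹`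
  obtain ⟨P, hP⟩ := exists_block_clm_family (𝕜 := ℂ) (w := fun _ : Bond d (towerP L m (n + 1)) => c₀) (V := W) piB
  have hblk : ∀ w, (∀ b', piB b' ≠ w → WL2.equiv ℂ (fun _ : Bond d (towerP L m (n + 1)) => c₀) W (P w q1v) b' = 0) ∧
      (∀ b', ‖WL2.equiv ℂ (fun _ : Bond d (towerP L m (n + 1)) => c₀) W (P w q1v) b'‖ ≤ α * Cq1 * F * Real.exp (-(δ₀ * tdist m w v))) := by
    intro w
    refine ⟨fun b' hb' => by rw [hP, if_neg hb'], fun b' => ?_⟩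
    rw [hP]; split_ifs with hb
    · exact (hq b').trans (le_of_eq (by rw [show E (bpos b') = Real.exp (-(δ₀ * tdist m w v)) by rw [hE]; dsimp only; rw [← hb]]))
    · rw [norm_zero]; positivity
  have hdecq : GpOfUk L m n φ η U a' (c₁ := c₁) hpos' (DsU q1v) = ∑ w, GpOfUk L m n φ η U a' (c₁ := c₁) hpos' (DsU (P w q1v)) := by
    conv_lhs => rw [← sum_block_apply hP q1v]; rw [map_sum, map_sum]
  have hsumq : ∀ x, WL2.equiv ℂ (fun _ : TSite d (towerP L m (n + 1)) => c₀) W (GpOfUk L m n φ η U a' (c₁ := c₁) hpos' (DsU q1v)) x =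
      ∑ w, WL2.equiv ℂ (fun _ : TSite d (towerP L m (n + 1)) => c₀) W (GpOfUk L m n φ η U a' (c₁ := c₁) hpos' (DsU (P w q1v))) x := fun x => by
    rw [hdecq]
    have e := map_sum (WL2.linearEquiv ℂ ℂ (fun _ : TSite d (towerP L m (n + 1)) => c₀) (V := W)) (fun w => GpOfUk L m n φ η U a' (c₁ := c₁) hpos' (DsU (P w q1v))) Finset.univ
    have e' : WL2.equiv ℂ (fun _ : TSite d (towerP L m (n + 1)) => c₀) W (∑ w, GpOfUk L m n φ η U a' (c₁ := c₁) hpos' (DsU (P w q1v))) =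
        ∑ w, WL2.equiv ℂ (fun _ : TSite d (towerP L m (n + 1)) => c₀) W (GpOfUk L m n φ η U a' (c₁ := c₁) hpos' (DsU (P w q1v))) := by simpa only [WL2.linearEquiv_apply] using e
    rw [e', Finset.sum_apply]
  have hSsum : ∀ w' : TSite d m, ∑ u, Real.exp (-((δ₀ - δ₀ / 2) * tdist m w' u)) ≤ S := fun w' => by
    rw [show δ₀ - δ₀ / 2 = δ₀ / 2 by ring]; exact torusSum_le d hm (half_pos hδ₀0) w'
  have hconv : ∀ x, ∑ w, Real.exp (-(δ₀ * tdist m (piS x) w)) * Real.exp (-(δ₀ * tdist m w v)) ≤ S * Real.exp (-(δ₀ / 2 * tdist m (piS x) v)) := fun x =>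
    sum_exp_mul_exp_le (fun u v => tdist_nonneg m u v) (fun u y v => tdist_triangle hm u y v) (half_pos hδ₀0).le (by linarith) hSsum (piS x) v
  have hqval : ∀ x, ‖WL2.equiv ℂ (fun _ : TSite d (towerP L m (n + 1)) => c₀) W (GpOfUk L m n φ η U a' (c₁ := c₁) hpos' (DsU q1v)) x‖ ≤ Bv * (α * Cq1 * F) * S * Real.exp (-(δ₀ / 2 * tdist m (piS x) v)) := by
    intro x; rw [hsumq]
    calc _ ≤ ∑ w, ‖WL2.equiv ℂ (fun _ : TSite d (towerP L m (n + 1)) => c₀) W (GpOfUk L m n φ η U a' (c₁ := c₁) hpos' (DsU (P w q1v))) x‖ := norm_sum_le _ _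
      _ ≤ ∑ w, Bv * Real.exp (-(δ₀ * tdist m (piS x) w)) * (α * Cq1 * F * Real.exp (-(δ₀ * tdist m w v))) := Finset.sum_le_sum fun w _ => by
          refine (HV n η hηL c₀ c₁ hw m U α hα hαv' hUb hUη hUgrad εU hεU hεg hUε hLb hUst hRlev hpos' w (P w q1v) _ (hblk w).1 (hblk w).2 x).trans ?_
          refine mul_le_mul_of_nonneg_right (mul_le_mul_of_nonneg_left (Real.exp_le_exp.2 ?_) hBv) (by positivity)
          nlinarith [tdist_nonneg m (piS x) w, hδ₀v]
      _ = Bv * (α * Cq1 * F) * ∑ w, Real.exp (-(δ₀ * tdist m (piS x) w)) * Real.exp (-(δ₀ * tdist m w v)) := by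
          rw [Finset.mul_sum]; exact Finset.sum_congr rfl fun w _ => by ring
      _ ≤ Bv * (α * Cq1 * F) * (S * Real.exp (-(δ₀ / 2 * tdist m (piS x) v))) := mul_le_mul_of_nonneg_left (hconv x) (by positivity)
      _ = _ := by ring
  have hqhold : ∀ x x', tdist (towerP L m (n + 1)) x x' ≤ K →
      ‖WL2.equiv ℂ (fun _ : TSite d (towerP L m (n + 1)) => c₀) W (GpOfUk L m n φ η U a' (c₁ := c₁) hpos' (DsU q1v)) x' - WL2.equiv ℂ (fun _ : TSite d (towerP L m (n + 1)) => c₀) W (GpOfUk L m n φ η U a' (c₁ := c₁) hpos' (DsU q1v)) x‖ ≤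
        Bh * (α * Cq1 * F) * S * Real.exp (-(δ₀ / 2 * tdist m (piS x) v)) * (tdist (towerP L m (n + 1)) x x' / K) ^ ((1 : ℝ) / 2) := by
    intro x x' hxx
    have hs0 : 0 ≤ (tdist (towerP L m (n + 1)) x x' / K) ^ ((1 : ℝ) / 2) := Real.rpow_nonneg (div_nonneg (tdist_nonneg _ x x') hK0.le) _
    rw [hsumq, hsumq, ← Finset.sum_sub_distrib]
    calc _ ≤ ∑ w, ‖WL2.equiv ℂ (fun _ : TSite d (towerP L m (n + 1)) => c₀) W (GpOfUk L m n φ η U a' (c₁ := c₁) hpos' (DsU (P w q1v))) x' -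
            WL2.equiv ℂ (fun _ : TSite d (towerP L m (n + 1)) => c₀) W (GpOfUk L m n φ η U a' (c₁ := c₁) hpos' (DsU (P w q1v))) x‖ := norm_sum_le _ _
      _ ≤ ∑ w, Bh * Real.exp (-(δ₀ * tdist m (piS x) w)) * (tdist (towerP L m (n + 1)) x x' / K) ^ ((1 : ℝ) / 2) * (α * Cq1 * F * Real.exp (-(δ₀ * tdist m w v))) :=
          Finset.sum_le_sum fun w _ => by
            refine (HH n η hηL c₀ c₁ hw m U α hα hαh' hUb hUη hUgrad εU hεU hεg hUε hLb hUst hRlev hpos' w (P w q1v) _ (hblk w).1 (hblk w).2 x x' hxx).trans ?_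
            refine mul_le_mul_of_nonneg_right (mul_le_mul_of_nonneg_right (mul_le_mul_of_nonneg_left (Real.exp_le_exp.2 ?_) hBh) hs0) (by positivity)
            nlinarith [tdist_nonneg m (piS x) w, hδ₀h]
      _ = Bh * (α * Cq1 * F) * (tdist (towerP L m (n + 1)) x x' / K) ^ ((1 : ℝ) / 2) * ∑ w, Real.exp (-(δ₀ * tdist m (piS x) w)) * Real.exp (-(δ₀ * tdist m w v)) := by
          rw [Finset.mul_sum]; exact Finset.sum_congr rfl fun w _ => by ring
      _ ≤ Bh * (α * Cq1 * F) * (tdist (towerP L m (n + 1)) x x' / K) ^ ((1 : ℝ) / 2) * (S * Real.exp (-(δ₀ / 2 * tdist m (piS x) v))) :=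
          mul_le_mul_of_nonneg_left (hconv x) (by positivity)
      _ = _ := by ring
  -- (4) THE IDENTITY and the assembly
  have hid : GpOfUk L m n φ η U a' (c₁ := c₁) hpos' (DsU f) - GpOfUk L m n φ η (fun _ : Bond d (towerP L m (n + 1)) => (1 : 𝔸ˣ)) a' (c₁ := c₁) hpos'₁ (Ds1 f) =
      GpOfUk L m n φ η U a' (c₁ := c₁) hpos' hdat - GpOfUk L m n φ η U a' (c₁ := c₁) hpos' (DsU q1v) := by
    rw [hhdat, hq1v, hs1v, hzf, hz1, hDsU, hDs1, hSd, hR, GpOfUk_covDiv_sub_flat_eq L φ n η c₀ c₁ m U hpos' hpos'₁ f, laplacePrimeAk_sub_flat_apply_eq L φ n η c₀ c₁ m U]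
    simp only [map_sub, map_add, LinearMap.sub_apply]; abel
  have hweak : ∀ x, Real.exp (-(δ₀ * tdist m (piS x) v)) ≤ Real.exp (-(δ₀ / 2 * tdist m (piS x) v)) := fun x =>
    Real.exp_le_exp.2 (by nlinarith [tdist_nonneg m (piS x) v, hδ₀0.le])
  have hKy1 : KA + Bv * Cq1 * S ≤ Ky := by rw [hKy]; nlinarith [mul_nonneg hBh (mul_nonneg hCq10 hS0), mul_nonneg hd0 (mul_nonneg (add_nonneg hKA0 (mul_nonneg hcT0 hKA0)) (Real.exp_nonneg δ₀))]
  have hKy2 : d * (KA + cT * KA) * Real.exp δ₀ + Bh * Cq1 * S ≤ Ky := by rw [hKy]; nlinarith [mul_nonneg hBv (mul_nonneg hCq10 hS0), hKA0]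
  refine ⟨fun x => ?_, fun x x' hxx => ?_⟩
  · rw [hid, WL2.equiv_sub, Pi.sub_apply]
    have hEx : 0 ≤ Real.exp (-(δ₀ / 2 * tdist m (piS x) v)) := Real.exp_nonneg _
    calc _ ≤ Br * latticeConst d (2 * κr - δ₀) * (α * Ch * F) * Real.exp (-(δ₀ / 2 * tdist m (piS x) v)) +
          Bv * (α * Cq1 * F) * S * Real.exp (-(δ₀ / 2 * tdist m (piS x) v)) :=
          (norm_sub_le _ _).trans (add_le_add ((hGval x).trans (mul_le_mul_of_nonneg_left (hweak x) (by positivity))) (hqval x))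
      _ = α * (KA + Bv * Cq1 * S) * Real.exp (-(δ₀ / 2 * tdist m (piS x) v)) * F := by rw [hKA]; ring
      _ ≤ α * Ky * Real.exp (-(δ₀ / 2 * tdist m (piS x) v)) * F := by gcongr
  · rw [hid, WL2.equiv_sub, Pi.sub_apply, Pi.sub_apply]
    have e : ∀ a₁ b₁ a₂ b₂ : W, a₁ - b₁ - (a₂ - b₂) = (a₁ - a₂) - (b₁ - b₂) := fun _ _ _ _ => by abel
    rw [e]
    have hs0 : 0 ≤ (tdist (towerP L m (n + 1)) x x' / K) ^ ((1 : ℝ) / 2) := Real.rpow_nonneg (div_nonneg (tdist_nonneg _ x x') hK0.le) _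
    have h1 := (hGhold x x' hxx).trans (mul_le_mul_of_nonneg_right (mul_le_mul_of_nonneg_left (hweak x) (by positivity)) hs0)
    have hEx : 0 ≤ Real.exp (-(δ₀ / 2 * tdist m (piS x) v)) := Real.exp_nonneg _
    refine (norm_sub_le _ _).trans ?_
    calc _ ≤ d * (Br * latticeConst d (2 * κr - δ₀) * (α * Ch * F) + 2 * Mφ * Mφ' * α * (Br * latticeConst d (2 * κr - δ₀) * (α * Ch * F))) * Real.exp δ₀ *
            Real.exp (-(δ₀ / 2 * tdist m (piS x) v)) * (tdist (towerP L m (n + 1)) x x' / K) ^ ((1 : ℝ) / 2) +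
          Bh * (α * Cq1 * F) * S * Real.exp (-(δ₀ / 2 * tdist m (piS x) v)) * (tdist (towerP L m (n + 1)) x x' / K) ^ ((1 : ℝ) / 2) := add_le_add h1 (hqhold x x' hxx)
      _ = α * (d * (KA + cT * (α * KA)) * Real.exp δ₀ + Bh * Cq1 * S) * Real.exp (-(δ₀ / 2 * tdist m (piS x) v)) *
            (tdist (towerP L m (n + 1)) x x' / K) ^ ((1 : ℝ) / 2) * F := by rw [hKA, hcT]; ring
      _ ≤ α * (d * (KA + cT * KA) * Real.exp δ₀ + Bh * Cq1 * S) * Real.exp (-(δ₀ / 2 * tdist m (piS x) v)) *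
            (tdist (towerP L m (n + 1)) x x' / K) ^ ((1 : ℝ) / 2) * F := by have hαKA : α * KA ≤ KA := mul_le_of_le_one_left hKA0 hα1; gcongr
      _ ≤ α * Ky * Real.exp (-(δ₀ / 2 * tdist m (piS x) v)) * (tdist (towerP L m (n + 1)) x x' / K) ^ ((1 : ℝ) / 2) * F := by gcongr

end Main

end Literature.MathematicalPhysics.QuantumFieldTheory.Balaban1983to89.B9Eq343GreenPrimeDstarTwoBackgroundHolderLetter

end
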